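import Mathlib.Algebra.Order.ToIntervalMod
import Mathlib.Algebra.Order.Floor.Semifield
import Mathlib.Analysis.SpecialFunctions.Trigonometric.Basic
import Mathlib.Data.Nat.Cast.Order.Field
import HarnessLib

/-!
# Angular sectors: the dyadic partition of the circle used in the sector decomposition
(Benfatto–Giuliani–Mastropietro 2003/2006), indices, centres, nesting and counting

Topic `Literature/MathematicalPhysics/QuantumLattice` (bookkeeping for the sector decomposition
of two-dimensional Fermi systems; model independent).

BGM 2006, §2.5 (p. 10 of the arXiv text): "we introduce the angles `θ_{h,ω} = (ω + ½)πγ^{h/2}`,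
with `ω` an integer in the set `O_h = {0, 1, …, γ^{-(h-1)/2} - 1}` (recall that `γ = 4`)", the
sectors being the arcs of width `πγ^{h/2}` around these centres (the "s-sectors" `S_{h,ω}` of
BGM 2003 (3.44a), Lemma 7.2: `|θ - θ_{h,ω}| ≤ πγ^{h/2}` up to the overlap of the smooth partition of
unity (2.45)); BGM 2003 §7.4 (s1.23): "given `ω̃ ∈ O_h`,
`|{ω ∈ O_{h'} : S_{h',ω} ⊂ S_{h,ω̃}}| = γ^{(h-h')/2}`" — the nesting count that drives the sector
counting lemma. With `γ = 4` and `n = -h ≥ 0`: width `w_n = π/2^n`, `2^{n+1}` sectors, centres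
`(ω + ½) w_n`, and each scale-`n` sector contains exactly `2^{n'-n}` scale-`n'` sectors.

Everything is PROVED (elementary `toIcoMod` / `Nat.floor` arithmetic); definitions with bodies:

* `sectorWidth n = π/2^n`, `sectorCount n = 2^{n+1}` (`sectorCount_mul_sectorWidth`: they tile `2π`),
  `sectorCenter n ω = (ω + ½) w_n`;
* `angleRep θ ∈ [0, 2π)` — the representative of a real angle mod `2π` (`toIcoMod`);
* `sectorIndex n θ = ⌊angleRep θ / w_n⌋` — THE sector of an angle: `sectorIndex_lt` (`< 2^{n+1}`),
  `sectorIndex_add_two_pi` / `_add_int_mul` (depends only on `θ mod 2π`), `mem_sectorArc_sectorIndex`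
  (`angleRep θ ∈ [ω w, (ω+1) w)` for `ω = sectorIndex`), `sectorIndex_eq_iff`,
  `abs_angleRep_sub_sectorCenter_le` (`|angleRep θ - θ_{n,ω}| ≤ w_n/2`, BGM 2003 Lemma 7.2:
  `|θ - θ_{h,ω}| ≤ πγ^{h/2}` with room to spare);
* **nesting** (`sectorIndex_div_pow`): for `n ≤ n'`, `sectorIndex n θ = sectorIndex n' θ / 2^{n'-n}`
  — the scale-`n'` sector of an angle determines its scale-`n` sector by integer division;
* **counting** (`card_filter_div_eq`, BGM 2003 (s1.23)): for `ω < 2^{n+1}`, exactly `2^{n'-n}`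
  indices `ω' < 2^{n'+1}` have `ω'/2^{n'-n} = ω`.

## Sources

* G. Benfatto, A. Giuliani, V. Mastropietro, Ann. Henri Poincaré 7 (2006) 809–898, §2.5 (2.45)
  (arXiv:cond-mat/0507686 p. 10). [BenfattoGiulianiMastropietro2006]
* G. Benfatto, A. Giuliani, V. Mastropietro, Ann. Henri Poincaré 4 (2003) 137–193, (3.44a),
  Lemma 7.2 and §7.4 (s1.23) (arXiv:cond-mat/0207210 pp. 26, 28). [BenfattoGiulianiMastropietro2003]
-/

noncomputable section

open Real Set

namespace Literature.MathematicalPhysics.QuantumLattice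

/-! ### Widths, counts, centres -/

/-- The sector width at scale `n = -h`: `w_n = π/2^n = πγ^{h/2}` (`γ = 4`). [cite: BenfattoGiulianiMastropietro2006, §2.5 (2.45)] -/
def sectorWidth (n : ℕ) : ℝ := π / 2 ^ n

/-- The number of sectors at scale `n`: `|O_h| = γ^{-(h-1)/2} = 2^{n+1}`. [cite: BenfattoGiulianiMastropietro2006, §2.5 (2.45)] -/
def sectorCount (n : ℕ) : ℕ := 2 ^ (n + 1)

/-- The sector centres `θ_{h,ω} = (ω + ½)πγ^{h/2} = (ω + ½) w_n`. [cite: BenfattoGiulianiMastropietro2006, §2.5 (2.45)] -/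
def sectorCenter (n ω : ℕ) : ℝ := ((ω : ℝ) + 1 / 2) * sectorWidth n

/-- `w_n > 0`. [folklore] -/
theorem sectorWidth_pos (n : ℕ) : 0 < sectorWidth n := by
  unfold sectorWidth; positivity

/-- **The sectors tile the circle**: `2^{n+1} · (π/2^n) = 2π`. [folklore] -/
theorem sectorCount_mul_sectorWidth (n : ℕ) : (sectorCount n : ℝ) * sectorWidth n = 2 * π := by
  rw [sectorCount, sectorWidth, Nat.cast_pow, pow_succ]
  push_cast
  field_simp

/-- Halving: `w_n = 2^{n'-n} w_{n'}` for `n ≤ n'`. [folklore] -/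
theorem sectorWidth_eq_pow_mul {n n' : ℕ} (h : n ≤ n') :
    sectorWidth n = (2 : ℝ) ^ (n' - n) * sectorWidth n' := by
  rw [sectorWidth, sectorWidth]
  have : (2 : ℝ) ^ n' = 2 ^ (n' - n) * 2 ^ n := by rw [← pow_add, Nat.sub_add_cancel h]
  rw [this]
  field_simp

/-! ### The representative of an angle in `[0, 2π)` and its sector index -/

/-- The representative of a real angle modulo `2π` in `[0, 2π)`. [folklore] -/
def angleRep (θ : ℝ) : ℝ := toIcoMod Real.two_pi_pos 0 θ

/-- `angleRep θ ∈ [0, 2π)`. [folklore] -/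
theorem angleRep_mem (θ : ℝ) : angleRep θ ∈ Ico 0 (2 * π) := by
  have h := toIcoMod_mem_Ico' Real.two_pi_pos θ
  exact h

/-- `angleRep` is `2π`-periodic: `angleRep (θ + m·2π) = angleRep θ`. [folklore] -/
theorem angleRep_add_int_mul (θ : ℝ) (m : ℤ) : angleRep (θ + m * (2 * π)) = angleRep θ := by
  rw [angleRep, angleRep, ← zsmul_eq_mul, toIcoMod_add_zsmul]

/-- `angleRep θ ≡ θ (mod 2π)`. [folklore] -/
theorem exists_angleRep_eq_add (θ : ℝ) : ∃ m : ℤ, angleRep θ = θ + m * (2 * π) := by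
  refine ⟨-toIcoDiv Real.two_pi_pos 0 θ, ?_⟩
  rw [angleRep, ← self_sub_toIcoDiv_zsmul, zsmul_eq_mul]
  push_cast
  ring

/-- **The sector index** of an angle at scale `n`: `⌊angleRep θ / w_n⌋`. [cite: BenfattoGiulianiMastropietro2006, §2.5 (2.45)] -/
def sectorIndex (n : ℕ) (θ : ℝ) : ℕ := ⌊angleRep θ / sectorWidth n⌋₊

/-- The sector index depends only on `θ mod 2π`. [folklore] -/
theorem sectorIndex_add_int_mul (n : ℕ) (θ : ℝ) (m : ℤ) :
    sectorIndex n (θ + m * (2 * π)) = sectorIndex n θ := by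
  rw [sectorIndex, sectorIndex, angleRep_add_int_mul]

/-- In particular `sectorIndex n (θ + 2π) = sectorIndex n θ`. [folklore] -/
theorem sectorIndex_add_two_pi (n : ℕ) (θ : ℝ) : sectorIndex n (θ + 2 * π) = sectorIndex n θ := by
  simpa using sectorIndex_add_int_mul n θ 1

/-- **`sectorIndex n θ < 2^{n+1}`**: the index lies in `O_h`. [cite: BenfattoGiulianiMastropietro2006, §2.5 (2.45)] -/
theorem sectorIndex_lt (n : ℕ) (θ : ℝ) : sectorIndex n θ < sectorCount n := by
  rw [sectorIndex, Nat.floor_lt (div_nonneg (angleRep_mem θ).1 (sectorWidth_pos n).le),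
    div_lt_iff₀ (sectorWidth_pos n), sectorCount_mul_sectorWidth]
  exact (angleRep_mem θ).2

/-- **The angle lies in its sector**: `angleRep θ ∈ [ω w_n, (ω+1) w_n)` with `ω = sectorIndex n θ`. [cite: BenfattoGiulianiMastropietro2003, §7.1 Lemma 7.2] -/
theorem mem_sectorArc_sectorIndex (n : ℕ) (θ : ℝ) :
    angleRep θ ∈ Ico ((sectorIndex n θ : ℝ) * sectorWidth n) ((sectorIndex n θ + 1 : ℝ) * sectorWidth n) := by
  have hw := sectorWidth_pos n
  have h0 : 0 ≤ angleRep θ / sectorWidth n := div_nonneg (angleRep_mem θ).1 hw.le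
  constructor
  · have := Nat.floor_le h0
    rw [sectorIndex, ← le_div_iff₀ hw]
    exact this
  · have := Nat.lt_floor_add_one (angleRep θ / sectorWidth n)
    rw [sectorIndex, ← div_lt_iff₀ hw]
    exact_mod_cast this

/-- Characterisation: `sectorIndex n θ = ω` iff `angleRep θ ∈ [ω w_n, (ω+1) w_n)`. [folklore] -/
theorem sectorIndex_eq_iff (n : ℕ) (θ : ℝ) (ω : ℕ) :
    sectorIndex n θ = ω ↔ angleRep θ ∈ Ico ((ω : ℝ) * sectorWidth n) ((ω + 1 : ℝ) * sectorWidth n) := by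
  have hw := sectorWidth_pos n
  have h0 : 0 ≤ angleRep θ / sectorWidth n := div_nonneg (angleRep_mem θ).1 hw.le
  rw [sectorIndex, Nat.floor_eq_iff h0, le_div_iff₀ hw, div_lt_iff₀ hw, mem_Ico]

/-- **Distance to the centre**: `|angleRep θ - θ_{n,ω}| ≤ w_n/2` for `ω = sectorIndex n θ`
(BGM 2003 Lemma 7.2: `|θ - θ_{h,ω}| ≤ πγ^{h/2}`). [cite: BenfattoGiulianiMastropietro2003, §7.1 Lemma 7.2] -/
theorem abs_angleRep_sub_sectorCenter_le (n : ℕ) (θ : ℝ) :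
    |angleRep θ - sectorCenter n (sectorIndex n θ)| ≤ sectorWidth n / 2 := by
  have h := mem_sectorArc_sectorIndex n θ
  rw [sectorCenter, abs_le]
  constructor <;> nlinarith [h.1, h.2, sectorWidth_pos n]

/-! ### Nesting and counting -/

/-- **Nesting**: for `n ≤ n'` the scale-`n` sector of an angle is determined by its scale-`n'`
sector through integer division by `2^{n'-n}` (each coarse sector is the union of `2^{n'-n}`
consecutive fine ones). [cite: BenfattoGiulianiMastropietro2003, §7.4 (s1.23)] -/
theorem sectorIndex_div_pow {n n' : ℕ} (h : n ≤ n') (θ : ℝ) :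
    sectorIndex n θ = sectorIndex n' θ / 2 ^ (n' - n) := by
  rw [sectorIndex, sectorIndex, sectorWidth_eq_pow_mul h, ← Nat.floor_div_natCast, Nat.cast_pow,
    Nat.cast_ofNat, div_div, mul_comm]

/-- **Counting** (BGM 2003 (s1.23): "given `ω̃ ∈ O_h`, `|{ω ∈ O_{h'} : S_{h',ω} ⊂ S_{h,ω̃}}| =
γ^{(h-h')/2}`"): for `ω < 2^{n+1}` and `n ≤ n'`, exactly `2^{n'-n}` fine indices `ω' < 2^{n'+1}`
satisfy `ω' / 2^{n'-n} = ω`. [cite: BenfattoGiulianiMastropietro2003, §7.4 (s1.23)] -/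
theorem card_filter_div_eq {n n' : ℕ} (h : n ≤ n') {ω : ℕ} (hω : ω < sectorCount n) :
    ((Finset.range (sectorCount n')).filter fun ω' => ω' / 2 ^ (n' - n) = ω).card = 2 ^ (n' - n) := by
  set m := 2 ^ (n' - n) with hm
  have hm0 : 0 < m := by positivity
  have hcount : sectorCount n' = sectorCount n * m := by
    rw [sectorCount, sectorCount, hm, ← pow_add]
    congr 1
    omega
  have hset : ((Finset.range (sectorCount n')).filter fun ω' => ω' / m = ω) = Finset.Ico (ω * m) ((ω + 1) * m) := by
    ext ω'
    rw [Finset.mem_filter, Finset.mem_range, Finset.mem_Ico, Nat.div_eq_iff hm0, hcount, add_mul, one_mul]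
    constructor
    · rintro ⟨-, h1, h2⟩
      exact ⟨h1, by omega⟩
    · rintro ⟨h1, h2⟩
      have hle : ω * m + m ≤ sectorCount n * m := by
        have := Nat.mul_le_mul_right m hω
        rw [Nat.succ_mul] at this
        exact this
      exact ⟨by omega, h1, by omega⟩
  rw [hset, Nat.card_Ico]
  rw [add_mul, one_mul, Nat.add_sub_cancel_left]

end Literature.MathematicalPhysics.QuantumLattice

end
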